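import Literature.MathematicalPhysics.QuantumFieldTheory.Balaban1983to89.B4Ineq110WalkRoute

/-!
# `Balaban1983to89.B4Ineq112WalkRoute` — [Balaban1983RegularityDecay] THEOREM (1.11)–(1.12), value member: the decay of
# `δG_k(Ω,Ω₀,A) = G_k(Ω,A) − G_k(Ω₀,A)` with the printed exponent «(2M)⁻¹(dist(x, supp f) + dist(x, Ω^c) +
# dist(supp f, Ω^c))», BY THE PRINTED CANCELLATION OF THE TWO WALK EXPANSIONS (p. 579), END TO END on the concrete
# operators, for EVERY pair of regions and EVERY configuration, modulo the per-cube sup inputs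

statement-level skeleton of published theorems with citation tags; proofs where landed; nothing here is a claim about the Yang–Mills mass gap

CITATION HEADER.  T. Bałaban, *Regularity and decay of lattice Green's functions*, Commun. Math. Phys. **89** (1983)
571–597, doi:10.1007/bf01214744 [Balaban1983RegularityDecay] (cell paper B4; held text
`paper:balaban1983-cmp89-regularity-decay`, journal page = PDF page + 570; pp. 573, 576–579, 581).  Unit `lit-balaban-r01`
gen 5 (B4 fold owner), HOME `run/shared/lean/pub/lit-balaban/`, SKELETON rows **B4.Thm@573** ((1.11)–(1.12) value member),
**B4.Cor2.3** (δG clause), **B4.Eq2.12**, **B4.Eq2.18**.  Theorems only; imports `B4Ineq110WalkRoute` (→ `B4Eq212SmallR`,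
`B4Eq213ConcreteWalk`, `B4LpChain221` → `B4RandomWalkDelta112`).  Norm: Mathlib's scope `Matrix.Norms.Operator`.

WHAT IS PRINTED (verbatim).  p. 573: *«If Ω ⊂ Ω₀, then for δG_k(Ω,Ω₀,A) defined by the equality (1.11)
δG_k(Ω,Ω₀,A) = G_k(Ω,A) − G_k(Ω₀,A), we have the inequalities (1.5) and (1.6)* ⟦= (1.9) and (1.10)⟧ *(with the same
restrictions on x, x′) with the additional factor (1.12) … on the right hand sides.»*; p. 579: *«To prove the
corresponding inequalities for δG_k(Ω,Ω₀,A) = G_k(Ω,A) − G_k(Ω₀,A) with Ω ⊂ Ω₀, we take the representations (2.13) for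
both propagators. The terms with ω such that □_{ω_i} are interior cubes of Ω are the same in both representations, so
they cancel in the difference, and for δG_k we get a representation similar to (2.13) with the additional restriction
that at least one □_{ω_i} intersects the boundary ∂Ω. We estimate the terms of the representation as above and we get
the first inequality in (2.22) with 2^{d+1} instead of 2^d and with the restriction n ≥ … ≥ (2M)⁻¹(dist({x,x′}, supp f)
+ dist({x,x′}, Ω^c) + dist(supp f, Ω^c)) − 3.»* (the abstract bookkeeping of this passage is the cell's
`B4RandomWalkDelta112.lattice_walk_delta_bound`).

WHAT THIS MODULE PROVES (all in full).
* §1, the cancellation mechanism on the concrete operators: `inv_mul_proj_congr` (`HG = 1`, `H′G′ = 1`, `HD = H′D`,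
  `DH = HD` ⇒ `GD = G′D`), `mulH_indicator_comm_covOp` (the Neumann-cut operator of a block-compatible set `S`
  commutes with `1_S`), `covOp_cut_mul_indicator_congr` (for `S ⊆ Ω` the cut at `∂S` does not see the cut at `∂Ω`
  on the block `S`), **`interior_letters_agree`** — «The terms with ω such that □_{ω_i} are interior cubes of Ω are
  the same in both representations»: for `S_j ⊆ Ω` the letters `h_jG_jh_j` and `K_jG_jh_j` of the two expansions
  COINCIDE.
* **`ineq112_value`** — setting: the sites `X` of `Ω₀` with `H = covOp c m² a q W T` (1.6) and `G′ = G_k(Ω₀,A)`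
  (`G′H = 1`); the sub-region `Ω` through the NEUMANN CUT `c^Ω(z,z′) = 1[z ∈ Ω ↔ z′ ∈ Ω]c(z,z′)` with `G` the inverse
  of `covOp c^Ω …` (`= G_k(Ω,A) ⊕` exterior part); block-compatible cube sets `S_j` between the `(7/8)M`- and the
  `M`-box; cube propagators `G_j`, `G_j^Ω` of norm `≤ γ`; factor bounds `≤ β`, (2.21) `3^dβ ≤ e⁻¹`.  Conclusion: for
  every site `x`, site set `F`, and reals `D ≤ dist_∞(x,F)`, `D₀ ≤ dist_∞(x,Ω^c)`, `D₁ ≤ dist_∞(F,Ω^c)`: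
  `‖1_x·(G − G′)·1_F‖ ≤ 2^{d+2}e^{17/4}γ·exp(−(D + D₀ + D₁)/(2M))`.  Far: `lattice_walk_delta_bound` over the label type
  `↥s` with the interior labels cancelling and every surviving walk passing a cube that meets `Ω^c` (label
  separation `⌊(D + D₀ + D₁)/(2M) − 13/4⌋` through it; `max(D, D₀ + D₁) ≥ (D + D₀ + D₁)/2`), then
  `B4LpChain221.tail_222`; near: `‖G‖ + ‖G′‖ ≤ 2^{d+2}γ` (`B4Ineq110WalkRoute.norm_le_of_neumann`).
* **`ineq112_value_apply`** — the printed shape for `f` supported in `F`: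
  `|(δG_k(Ω,Ω₀,A)f)(x)| ≤ 2^{d+2}e^{17/4}γ·exp(−(D + D₀ + D₁)/(2M))·sup|f|`.

HONEST SCOPE.  As in `B4Ineq110WalkRoute`: value member only; the sup inputs `γ, β` are ASSUMED for every cube of
BOTH families (no `R₀`; Lemmas 2.1/2.2 at `Ã_j` = reserve R9 at `A ≠ 0`); `Ω ⊂ Ω₀` is modelled by the Neumann cut of
the bond weights inside the common site set (so `G` is `G_k(Ω,A)` on `Ω` plus a decoupled exterior part, which the
cut-offs `1_x`, `1_F` with `x ∈ Ω`, `F ⊆ Ω` never see — the statement holds for all `x`, `F`).  No `def`, no `Prop`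
fact, no `sorry`; axioms standard.
-/

namespace Literature.MathematicalPhysics.QuantumFieldTheory.Balaban1983to89.B4Ineq112WalkRoute

open Literature.MathematicalPhysics.QuantumFieldTheory.Balaban1983to89.B4GaugeCovariance
open Literature.MathematicalPhysics.QuantumFieldTheory.Balaban1983to89.B4Commutators25to211
open Literature.MathematicalPhysics.QuantumFieldTheory.Balaban1983to89.B4PartitionUnity22
open Literature.MathematicalPhysics.QuantumFieldTheory.Balaban1983to89.B4RandomWalk213
open Literature.MathematicalPhysics.QuantumFieldTheory.Balaban1983to89.B4RandomWalkDelta112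
open Literature.MathematicalPhysics.QuantumFieldTheory.Balaban1983to89.B4LpChain221
open Literature.MathematicalPhysics.QuantumFieldTheory.Balaban1983to89.B4Eq213Locality
open Literature.MathematicalPhysics.QuantumFieldTheory.Balaban1983to89.B4Eq26Locality
open Literature.MathematicalPhysics.QuantumFieldTheory.Balaban1983to89.B4Eq213ConcreteWalk
open Literature.MathematicalPhysics.QuantumFieldTheory.Balaban1983to89.B4Eq212SmallR
open Literature.MathematicalPhysics.QuantumFieldTheory.Balaban1983to89.B4Ineq110WalkRoute
open scoped Matrix NNReal

open scoped Matrix.Norms.Operator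

/-! ## §1. «The terms with ω such that □_{ω_i} are interior cubes of Ω are the same in both representations» (p. 579):
the cube letters of an INTERIOR cube do not see the Neumann cut at `∂Ω` -/

section Interior

variable {X Y κ : Type*} [Fintype X] [Fintype Y] [Fintype κ] [DecidableEq X] [DecidableEq κ]

/-- inverses of two operators that AGREE on a block `D` and the first of which commutes with `D` agree on that block:
`HG = 1`, `H′G′ = 1`, `HD = H′D`, `DH = HD` ⇒ `GD = G′D`. [cite: Balaban1983RegularityDecay, p.579 (the cancellation of interior cubes)] -/
theorem inv_mul_proj_congr {H H' G G' D : Matrix (X × κ) (X × κ) ℝ} (hHG : H * G = 1) (hH'G' : H' * G' = 1)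
    (hD : H * D = H' * D) (hcomm : D * H = H * D) : G * D = G' * D := by
  have hGH : G * H = 1 := mul_eq_one_comm.mp hHG
  have hG'H' : G' * H' = 1 := mul_eq_one_comm.mp hH'G'
  have hGD : G * D = D * G := by
    calc G * D = G * D * (H * G) := by rw [hHG, Matrix.mul_one]
      _ = G * (D * H) * G := by simp only [Matrix.mul_assoc]
      _ = G * (H * D) * G := by rw [hcomm]
      _ = (G * H) * (D * G) := by simp only [Matrix.mul_assoc]
      _ = D * G := by rw [hGH, Matrix.one_mul]
  have h1 : G' * H * D = D := by rw [Matrix.mul_assoc, hD, ← Matrix.mul_assoc, hG'H', Matrix.one_mul]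
  calc G * D = D * G := hGD
    _ = G' * H * D * G := by rw [h1]
    _ = G' * H * (D * G) := by simp only [Matrix.mul_assoc]
    _ = G' * H * (G * D) := by rw [hGD]
    _ = G' * (H * G) * D := by simp only [Matrix.mul_assoc]
    _ = G' * D := by rw [hHG, Matrix.mul_one]

/-- the Neumann-cut operator of a block-compatible site set `S` COMMUTES with `1_S` (no bond and no block of `aQ^*Q`
crosses `∂S`): `[1_S, H_S] = 0`. [cite: Balaban1983RegularityDecay, (2.6) p.576] -/
theorem mulH_indicator_comm_covOp (c : X → X → ℝ) (m2 a : ℝ) (q : Y → X → ℝ) (W : X → X → Matrix κ κ ℝ)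
    (T : Y → X → Matrix κ κ ℝ) (S : X → Prop) [DecidablePred S]
    (hSq : ∀ y z z', q y z ≠ 0 → q y z' ≠ 0 → (S z ↔ S z')) :
    mulH (ι := κ) (fun z => if S z then (1 : ℝ) else 0)
        * covOp (fun z z' => if (S z ↔ S z') then c z z' else 0) m2 a q W T
      = covOp (fun z z' => if (S z ↔ S z') then c z z' else 0) m2 a q W T
        * mulH (ι := κ) (fun z => if S z then (1 : ℝ) else 0) := by
  rw [← sub_eq_zero]
  change opK (fun z z' => if (S z ↔ S z') then c z z' else 0) m2 a q W T (fun z => if S z then (1 : ℝ) else 0) = 0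
  rw [opK_eq_blockOp, ← blockOp_zero]
  congr 1
  funext z z'
  by_cases hzz : (S z ↔ S z')
  · have : (if S z then (1 : ℝ) else 0) - (if S z' then (1 : ℝ) else 0) = 0 := by
      by_cases hz : S z
      · rw [if_pos hz, if_pos (hzz.mp hz), sub_self]
      · rw [if_neg hz, if_neg (fun h => hz (hzz.mpr h)), sub_self]
    rw [this, zero_smul]
    rfl
  · have hne : z ≠ z' := by rintro rfl; exact hzz Iff.rfl
    have hK : covLapKer (fun z z' => if (S z ↔ S z') then c z z' else 0) W z z' = 0 := by
      rw [covLapKer, if_neg hne, if_neg hne, if_neg hzz, if_neg (fun h => hzz h.symm)]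
      simp
    have hP : ∑ y, (q y z * q y z') • ((T y z)ᵀ * T y z') = 0 := by
      refine Finset.sum_eq_zero fun y _ => ?_
      have : q y z * q y z' = 0 := by
        by_contra h0
        rcases mul_ne_zero_iff.mp h0 with ⟨h1, h2⟩
        exact hzz (hSq y z z' h1 h2)
      rw [this, zero_smul]
    rw [hK, hP, smul_zero, add_zero, smul_zero]
    rfl

/-- for an INTERIOR site set `S ⊆ Ω` the Neumann cut at `∂S` does not see the further cut at `∂Ω`: the two cube
operators agree on the block `S`, `H_S(c)·1_S = H_S(c^Ω)·1_S`. [cite: Balaban1983RegularityDecay, p.579] -/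
theorem covOp_cut_mul_indicator_congr (c : X → X → ℝ) (m2 a : ℝ) (q : Y → X → ℝ) (W : X → X → Matrix κ κ ℝ)
    (T : Y → X → Matrix κ κ ℝ) (S Ω : X → Prop) [DecidablePred S] [DecidablePred Ω] (hSΩ : ∀ z, S z → Ω z) :
    covOp (fun z z' => if (S z ↔ S z') then c z z' else 0) m2 a q W T
        * mulH (ι := κ) (fun z => if S z then (1 : ℝ) else 0)
      = covOp (fun z z' => if (S z ↔ S z') then (if (Ω z ↔ Ω z') then c z z' else 0) else 0) m2 a q W T
        * mulH (ι := κ) (fun z => if S z then (1 : ℝ) else 0) := by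
  have key : ∀ x z', S z' →
      (if (S x ↔ S z') then c x z' else 0) = (if (S x ↔ S z') then (if (Ω x ↔ Ω z') then c x z' else 0) else 0)
      ∧ (if (S z' ↔ S x) then c z' x else 0)
        = (if (S z' ↔ S x) then (if (Ω z' ↔ Ω x) then c z' x else 0) else 0) := by
    intro x z' hz'
    by_cases hx : S x
    · have hΩ : (Ω x ↔ Ω z') := ⟨fun _ => hSΩ z' hz', fun _ => hSΩ x hx⟩
      rw [if_pos hΩ, if_pos hΩ.symm]
      exact ⟨rfl, rfl⟩
    · rw [if_neg (fun h => hx (h.mpr hz')), if_neg (fun h => hx (h.mpr hz')), if_neg (fun h => hx (h.mp hz')),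
        if_neg (fun h => hx (h.mp hz'))]
      exact ⟨rfl, rfl⟩
  refine covOp_mul_mulH_congr m2 a _ ?_ (fun _ _ _ => ⟨fun _ => rfl, fun _ => rfl⟩)
    (fun _ _ _ _ _ => ⟨rfl, fun _ => rfl⟩)
  intro z' hz' x
  have hS : S z' := by
    by_contra h
    exact hz' (if_neg h)
  exact key x z' hS

omit [Fintype Y] in
/-- a function supported in `S` does not see `1_S`: `1_S·h = h` as multiplication operators. [cite: Balaban1983RegularityDecay, (2.2) p.575] -/
theorem indicator_mul_mulH_of_supp (S : X → Prop) [DecidablePred S] (h : X → ℝ) (hh : ∀ z, h z ≠ 0 → S z) :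
    mulH (ι := κ) (fun z => if S z then (1 : ℝ) else 0) * mulH (ι := κ) h = mulH (ι := κ) h := by
  rw [mulH_mul_mulH]
  congr 1
  funext z
  by_cases hz : S z
  · rw [if_pos hz, one_mul]
  · have : h z = 0 := by
      by_contra hne
      exact hz (hh z hne)
    rw [if_neg hz, zero_mul, this]

omit [Fintype Y] in
/-- symmetric form: `h·1_S = h`. [cite: Balaban1983RegularityDecay, (2.2) p.575] -/
theorem mulH_mul_indicator_of_supp (S : X → Prop) [DecidablePred S] (h : X → ℝ) (hh : ∀ z, h z ≠ 0 → S z) :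
    mulH (ι := κ) h * mulH (ι := κ) (fun z => if S z then (1 : ℝ) else 0) = mulH (ι := κ) h := by
  rw [mulH_mul_mulH]
  congr 1
  funext z
  by_cases hz : S z
  · rw [if_pos hz, mul_one]
  · have : h z = 0 := by
      by_contra hne
      exact hz (hh z hne)
    rw [if_neg hz, mul_zero, this]

/-- **INTERIOR CUBES CANCEL** (p. 579 «The terms with ω such that □_{ω_i} are interior cubes of Ω are the same in both
representations»): for a block-compatible cut set `S ⊆ Ω` carrying `h` (`supp h ⊆ S`), the letters `hG_Sh` and
`K·G_S·h` built from the cube operator `H_S(c)` (expansion of `G_k(Ω₀,A)`) and from `H_S(c^Ω)` (expansion of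
`G_k(Ω,A)`) COINCIDE. [cite: Balaban1983RegularityDecay, p.579] -/
theorem interior_letters_agree (c : X → X → ℝ) (m2 a : ℝ) (q : Y → X → ℝ) (W : X → X → Matrix κ κ ℝ)
    (T : Y → X → Matrix κ κ ℝ) (S Ω : X → Prop) [DecidablePred S] [DecidablePred Ω] (hSΩ : ∀ z, S z → Ω z)
    (hSq : ∀ y z z', q y z ≠ 0 → q y z' ≠ 0 → (S z ↔ S z')) (h : X → ℝ) (hh : ∀ z, h z ≠ 0 → S z)
    {G G' : Matrix (X × κ) (X × κ) ℝ}
    (hG : covOp (fun z z' => if (S z ↔ S z') then c z z' else 0) m2 a q W T * G = 1)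
    (hG' : covOp (fun z z' => if (S z ↔ S z') then (if (Ω z ↔ Ω z') then c z z' else 0) else 0) m2 a q W T
      * G' = 1) :
    mulH (ι := κ) h * G * mulH (ι := κ) h = mulH (ι := κ) h * G' * mulH (ι := κ) h
    ∧ opK (fun z z' => if (S z ↔ S z') then c z z' else 0) m2 a q W T h * G * mulH (ι := κ) h
      = opK (fun z z' => if (S z ↔ S z') then (if (Ω z ↔ Ω z') then c z z' else 0) else 0) m2 a q W T h * G'
        * mulH (ι := κ) h := by
  -- the cut at `∂Ω` of the already `S`-cut weights is the `S`-cut of the `Ω`-cut weights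
  have hcc : (fun z z' => if (S z ↔ S z') then (if (Ω z ↔ Ω z') then c z z' else 0) else 0)
      = fun z z' => if (S z ↔ S z') then (fun z z' => if (Ω z ↔ Ω z') then c z z' else (0 : ℝ)) z z' else 0 := rfl
  set D : Matrix (X × κ) (X × κ) ℝ := mulH (ι := κ) (fun z => if S z then (1 : ℝ) else 0) with hDdef
  have hHD := covOp_cut_mul_indicator_congr (κ := κ) c m2 a q W T S Ω hSΩ
  have hcomm := mulH_indicator_comm_covOp (κ := κ) c m2 a q W T S hSq
  have hcomm' := mulH_indicator_comm_covOp (κ := κ) (fun z z' => if (Ω z ↔ Ω z') then c z z' else 0) m2 a q W T S hSq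
  have hGD : G * D = G' * D := inv_mul_proj_congr hG hG' hHD hcomm
  have hDh : D * mulH (ι := κ) h = mulH (ι := κ) h := indicator_mul_mulH_of_supp S h hh
  have hhD : mulH (ι := κ) h * D = mulH (ι := κ) h := mulH_mul_indicator_of_supp S h hh
  constructor
  · calc mulH (ι := κ) h * G * mulH (ι := κ) h = mulH (ι := κ) h * (G * D) * mulH (ι := κ) h := by
          rw [← hDh]; simp only [Matrix.mul_assoc, hDh]
      _ = mulH (ι := κ) h * (G' * D) * mulH (ι := κ) h := by rw [hGD]
      _ = mulH (ι := κ) h * G' * mulH (ι := κ) h := by simp only [Matrix.mul_assoc, hDh]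
  · -- the commutators agree: `hH = hDH = hHD`-type bookkeeping with `HD = H'D`, `DH = HD`, `DH' = H'D`
    have hK : opK (fun z z' => if (S z ↔ S z') then c z z' else 0) m2 a q W T h
        = opK (fun z z' => if (S z ↔ S z') then (if (Ω z ↔ Ω z') then c z z' else 0) else 0) m2 a q W T h := by
      unfold opK
      have e1 : mulH (ι := κ) h * covOp (fun z z' => if (S z ↔ S z') then c z z' else 0) m2 a q W T
          = mulH (ι := κ) h
            * covOp (fun z z' => if (S z ↔ S z') then (if (Ω z ↔ Ω z') then c z z' else 0) else 0) m2 a q W T := by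
        calc mulH (ι := κ) h * covOp (fun z z' => if (S z ↔ S z') then c z z' else 0) m2 a q W T
            = mulH (ι := κ) h * (D * covOp (fun z z' => if (S z ↔ S z') then c z z' else 0) m2 a q W T) := by
                rw [← Matrix.mul_assoc, hhD]
          _ = mulH (ι := κ) h * (covOp (fun z z' => if (S z ↔ S z') then c z z' else 0) m2 a q W T * D) := by
                rw [hcomm]
          _ = mulH (ι := κ) h
              * (covOp (fun z z' => if (S z ↔ S z') then (if (Ω z ↔ Ω z') then c z z' else 0) else 0) m2 a q W T
                * D) := by rw [hHD]
          _ = mulH (ι := κ) h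
              * (D * covOp (fun z z' => if (S z ↔ S z') then (if (Ω z ↔ Ω z') then c z z' else 0) else 0)
                m2 a q W T) := by rw [hcc, ← hcomm']
          _ = _ := by rw [← Matrix.mul_assoc, hhD]
      have e2 : covOp (fun z z' => if (S z ↔ S z') then c z z' else 0) m2 a q W T * mulH (ι := κ) h
          = covOp (fun z z' => if (S z ↔ S z') then (if (Ω z ↔ Ω z') then c z z' else 0) else 0) m2 a q W T
            * mulH (ι := κ) h := by
        calc covOp (fun z z' => if (S z ↔ S z') then c z z' else 0) m2 a q W T * mulH (ι := κ) h
            = covOp (fun z z' => if (S z ↔ S z') then c z z' else 0) m2 a q W T * D * mulH (ι := κ) h := by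
                rw [Matrix.mul_assoc, hDh]
          _ = covOp (fun z z' => if (S z ↔ S z') then (if (Ω z ↔ Ω z') then c z z' else 0) else 0) m2 a q W T
              * D * mulH (ι := κ) h := by rw [hHD]
          _ = _ := by rw [Matrix.mul_assoc, hDh]
      rw [e1, e2]
    calc opK (fun z z' => if (S z ↔ S z') then c z z' else 0) m2 a q W T h * G * mulH (ι := κ) h
        = opK (fun z z' => if (S z ↔ S z') then c z z' else 0) m2 a q W T h * (G * D) * mulH (ι := κ) h := by
            simp only [Matrix.mul_assoc, hDh]
      _ = opK (fun z z' => if (S z ↔ S z') then (if (Ω z ↔ Ω z') then c z z' else 0) else 0) m2 a q W T h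
          * (G' * D) * mulH (ι := κ) h := by rw [hGD, hK]
      _ = _ := by simp only [Matrix.mul_assoc, hDh]

end Interior

/-! ## §2. THEOREM (1.11)–(1.12), value member: the decay of `δG_k(Ω,Ω₀,A) = G_k(Ω,A) − G_k(Ω₀,A)` with the extra factor,
by the cancellation of the two walk expansions — for EVERY pair of regions and EVERY `A`, modulo the per-cube inputs -/

section Route

variable {X Y κ : Type*} [Fintype X] [Fintype Y] [Fintype κ] [DecidableEq X] [DecidableEq κ] {d : ℕ}

/-- the labels that can see the site `x` number at most `2^d`. [cite: Balaban1983RegularityDecay, §2 p.575] -/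
private theorem card_labelBox_le (M : ℝ) (x : Fin d → ℝ) :
    (Fintype.piFinset fun μ => ({⌊x μ / M⌋, ⌊x μ / M⌋ + 1} : Finset ℤ)).card ≤ 2 ^ d := by
  rw [Fintype.card_piFinset]
  calc ∏ μ, ({⌊x μ / M⌋, ⌊x μ / M⌋ + 1} : Finset ℤ).card ≤ 2 ^ (Finset.univ : Finset (Fin d)).card :=
        Finset.prod_le_pow_card _ _ 2 fun μ _ => Finset.card_le_two
    _ = 2 ^ d := by rw [Finset.card_univ, Fintype.card_fin]

/-- `e⁻¹ ≤ 1/2`. [folklore] -/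
private theorem exp_neg_one_le_half : Real.exp (-1) ≤ 1 / 2 := by
  have h := Real.add_one_le_exp (1 : ℝ)
  rw [Real.exp_neg, inv_eq_one_div]
  exact one_div_le_one_div_of_le (by norm_num) (by linarith)

/-- a row sum is at most the `ℓ^∞`-operator norm. [folklore] -/
private theorem row_sum_le_norm {m n : Type*} [Fintype m] [Fintype n] (A : Matrix m n ℝ) (i : m) :
    ∑ j, |A i j| ≤ ‖A‖ := by
  rw [Matrix.linfty_opNorm_def]
  have h : (∑ j, ‖A i j‖₊ : ℝ≥0) ≤ Finset.univ.sup fun i => ∑ j, ‖A i j‖₊ :=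
    Finset.le_sup (f := fun i => ∑ j, ‖A i j‖₊) (Finset.mem_univ i)
  have h' := NNReal.coe_le_coe.mpr h
  simp only [NNReal.coe_sum, coe_nnnorm, Real.norm_eq_abs] at h'
  exact h'

/-- `|(Af)_i| ≤ ‖A‖·sup|f|`. [folklore] -/
private theorem abs_mulVec_le {m n : Type*} [Fintype m] [Fintype n] (A : Matrix m n ℝ) (f : n → ℝ) {φ : ℝ}
    (hφ : 0 ≤ φ) (hf : ∀ j, |f j| ≤ φ) (i : m) : |(A *ᵥ f) i| ≤ ‖A‖ * φ := by
  rw [Matrix.mulVec, dotProduct]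
  calc |∑ j, A i j * f j| ≤ ∑ j, |A i j * f j| := Finset.abs_sum_le_sum_abs _ _
    _ ≤ ∑ j, |A i j| * φ := Finset.sum_le_sum fun j _ => by
        rw [abs_mul]; exact mul_le_mul_of_nonneg_left (hf j) (abs_nonneg _)
    _ = (∑ j, |A i j|) * φ := by rw [Finset.sum_mul]
    _ ≤ ‖A‖ * φ := mul_le_mul_of_nonneg_right (row_sum_le_norm A i) hφ

/-- **THEOREM (1.11)–(1.12), VALUE MEMBER, BY THE PRINTED CANCELLATION OF THE TWO WALK EXPANSIONS (p. 579), END TO END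
on [B4]'s concrete operators, for EVERY pair of regions `Ω ⊂ Ω₀` and EVERY configuration `A`, modulo the per-cube sup
inputs.**  Setting: the sites `X` of `Ω₀` with the operator `H = covOp c m² a q W T` (1.6) and its inverse `G′ = G_k(Ω₀,A)`;
the sub-region `Ω` (a site predicate) entering through the NEUMANN CUT of the bond weights at `∂Ω`,
`c^Ω(z,z′) = 1[z ∈ Ω ↔ z′ ∈ Ω]c(z,z′)`, with inverse `G = G_k(Ω,A) ⊕ (exterior part)`; the constructed partition of unity
`h_j`; block-compatible cube sets `S_j` (`(7/8)M`-box `⊆ S_j ⊆ M`-box, no averaging block crosses `∂S_j`) with cube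
propagators `G_j` (cut of `c`) and `G_j^Ω` (cut of `c^Ω`), all of norm `≤ γ`, factor bounds `≤ β` with (2.21) `3^dβ ≤ e⁻¹`.
Then for every site `x`, site set `F` and reals `D ≤ dist_∞(x,F)`, `D₀ ≤ dist_∞(x,Ω^c)`, `D₁ ≤ dist_∞(F,Ω^c)`:
`‖1_x·(G_k(Ω,A) − G_k(Ω₀,A))·1_F‖ ≤ 2^{d+2}e^{17/4}γ·exp(−(D + D₀ + D₁)/(2M))` — the printed exponent
«(2M)⁻¹(dist(x, supp f) + dist(x, Ω^c) + dist(supp f, Ω^c))» of p. 579.  Mechanism: interior cubes (`S_j ⊆ Ω`) give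
IDENTICAL letters in both expansions (`interior_letters_agree`), so only walks through a cube meeting `Ω^c` survive
(`B4RandomWalkDelta112.lattice_walk_delta_bound`, factor `2`, «2^{d+1} instead of 2^d»); near the diagonal the sizes
`‖G‖, ‖G′‖ ≤ 2^{d+1}γ` suffice.  HONEST SCOPE as in `B4Ineq110WalkRoute.ineq110_value` (sup inputs assumed for every
cube of both families; value member only).
[cite: Balaban1983RegularityDecay, Theorem (1.11)–(1.12) p.573; p.579 (between (2.22) and (2.23)); Cor. 2.3 p.581] -/
theorem ineq112_value {M : ℝ} (hM : 0 < M) (pos : X → Fin d → ℝ) (c : X → X → ℝ) (m2 a : ℝ)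
    (q : Y → X → ℝ) (W : X → X → Matrix κ κ ℝ) (T : Y → X → Matrix κ κ ℝ)
    (hc : ∀ x z', c x z' ≠ 0 → ∀ μ, |pos x μ - pos z' μ| ≤ 1 / 8 * M)
    (hq : ∀ y x z', q y x ≠ 0 → q y z' ≠ 0 → ∀ μ, |pos x μ - pos z' μ| ≤ 1 / 8 * M)
    (s : Finset (Fin d → ℤ)) (hs : ∀ j x, hCube M j (pos x) ≠ 0 → j ∈ s)
    (S : (Fin d → ℤ) → X → Prop) [∀ j, DecidablePred (S j)]
    (hS : ∀ j z, (∀ μ, |pos z μ - M * j μ| ≤ 7 / 8 * M) → S j z)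
    (hS1 : ∀ j z, S j z → ∀ μ, |pos z μ - M * j μ| ≤ M)
    (hSq : ∀ j y z z', q y z ≠ 0 → q y z' ≠ 0 → (S j z ↔ S j z'))
    (W' : (Fin d → ℤ) → X → X → Matrix κ κ ℝ) (T' : (Fin d → ℤ) → Y → X → Matrix κ κ ℝ)
    (hWW' : ∀ j x z', (∀ μ, |pos x μ - M * j μ| ≤ 3 / 4 * M) → (∀ μ, |pos z' μ - M * j μ| ≤ 3 / 4 * M) →
      W' j x z' = W x z')
    (hTT' : ∀ j y x, q y x ≠ 0 → (∀ μ, |pos x μ - M * j μ| ≤ 3 / 4 * M) → T' j y x = T y x)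
    (Ω : X → Prop) [DecidablePred Ω]
    (Gj : (Fin d → ℤ) → Matrix (X × κ) (X × κ) ℝ)
    (hGj : ∀ j ∈ s, covOp (fun z z' => if (S j z ↔ S j z') then c z z' else 0) m2 a q (W' j) (T' j) * Gj j = 1)
    (GjΩ : (Fin d → ℤ) → Matrix (X × κ) (X × κ) ℝ)
    (hGjΩ : ∀ j ∈ s, covOp (fun z z' => if (S j z ↔ S j z') then (if (Ω z ↔ Ω z') then c z z' else 0) else 0)
      m2 a q (W' j) (T' j) * GjΩ j = 1)
    (G : Matrix (X × κ) (X × κ) ℝ) (hGH : G * covOp (fun z z' => if (Ω z ↔ Ω z') then c z z' else 0) m2 a q W T = 1)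
    (G' : Matrix (X × κ) (X × κ) ℝ) (hG'H : G' * covOp c m2 a q W T = 1)
    -- the per-cube analytic inputs, for both families of cubes
    {γ β : ℝ} (hγ0 : 0 ≤ γ) (hγ : ∀ i : ↥s, ‖Gj i.1‖ ≤ γ) (hγΩ : ∀ i : ↥s, ‖GjΩ i.1‖ ≤ γ) (hβ0 : 0 ≤ β)
    (hβ : ∀ i : ↥s, ‖opK (fun z z' => if (S i.1 z ↔ S i.1 z') then c z z' else 0) m2 a q (W' i.1) (T' i.1)
        (fun z => hCube M i.1 (pos z)) * Gj i.1 * mulH (ι := κ) (fun z => hCube M i.1 (pos z))‖ ≤ β)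
    (hβΩ : ∀ i : ↥s, ‖opK (fun z z' => if (S i.1 z ↔ S i.1 z') then (if (Ω z ↔ Ω z') then c z z' else 0) else 0)
        m2 a q (W' i.1) (T' i.1) (fun z => hCube M i.1 (pos z)) * GjΩ i.1
        * mulH (ι := κ) (fun z => hCube M i.1 (pos z))‖ ≤ β)
    (h3β : (3 : ℝ) ^ d * β ≤ Real.exp (-1))
    -- the site, the support set, and the three separations
    (x : X) (F : X → Prop) [DecidablePred F] {D D₀ D₁ : ℝ}
    (hD : ∀ x', F x' → ∃ μ, D ≤ |pos x μ - pos x' μ|)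
    (hD₀ : ∀ x₁, ¬ Ω x₁ → ∃ μ, D₀ ≤ |pos x μ - pos x₁ μ|)
    (hD₁ : ∀ x', F x' → ∀ x₁, ¬ Ω x₁ → ∃ μ, D₁ ≤ |pos x₁ μ - pos x' μ|) :
    ‖mulH (ι := κ) (fun z => if z = x then (1 : ℝ) else 0) * (G - G')
        * mulH (ι := κ) (fun z => if F z then (1 : ℝ) else 0)‖
      ≤ 2 ^ (d + 2) * Real.exp (17 / 4) * γ * Real.exp (-((D + D₀ + D₁) / (2 * M))) := by
  classical
  -- the letters of the two expansions
  set h : (Fin d → ℤ) → X → ℝ := fun j z => hCube M j (pos z) with hh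
  set cΩ : X → X → ℝ := fun z z' => if (Ω z ↔ Ω z') then c z z' else 0 with hcΩ
  set cut : (Fin d → ℤ) → X → X → ℝ := fun j z z' => if (S j z ↔ S j z') then c z z' else 0 with hcut
  set cutΩ : (Fin d → ℤ) → X → X → ℝ := fun j z z' => if (S j z ↔ S j z') then cΩ z z' else 0 with hcutΩ
  set aJ : (Fin d → ℤ) → Matrix (X × κ) (X × κ) ℝ :=
    fun j => mulH (ι := κ) (h j) * Gj j * mulH (ι := κ) (h j) with haJ
  set bJ : (Fin d → ℤ) → Matrix (X × κ) (X × κ) ℝ :=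
    fun j => opK (cut j) m2 a q (W' j) (T' j) (h j) * Gj j * mulH (ι := κ) (h j) with hbJ
  set aΩ : (Fin d → ℤ) → Matrix (X × κ) (X × κ) ℝ :=
    fun j => mulH (ι := κ) (h j) * GjΩ j * mulH (ι := κ) (h j) with haΩ
  set bΩ : (Fin d → ℤ) → Matrix (X × κ) (X × κ) ℝ :=
    fun j => opK (cutΩ j) m2 a q (W' j) (T' j) (h j) * GjΩ j * mulH (ι := κ) (h j) with hbΩ
  set P : Matrix (X × κ) (X × κ) ℝ := mulH (ι := κ) (fun z => if z = x then (1 : ℝ) else 0) with hPdef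
  set P' : Matrix (X × κ) (X × κ) ℝ := mulH (ι := κ) (fun z => if F z then (1 : ℝ) else 0) with hP'def
  -- locality of the cut weights
  have hcΩloc : ∀ x z', cΩ x z' ≠ 0 → ∀ μ, |pos x μ - pos z' μ| ≤ 1 / 8 * M :=
    fun x z' hne μ => cut_local pos c Ω hc x z' hne μ
  have hM8 : 1 / 8 * M ≤ 3 / 4 * M := by nlinarith
  have hcut_loc : ∀ l z z', cut l z z' ≠ 0 → ∀ μ, |pos z μ - pos z' μ| ≤ 3 / 4 * M :=
    fun l z z' hne μ => (cut_local pos c (S l) hc z z' hne μ).trans hM8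
  have hcutΩ_loc : ∀ l z z', cutΩ l z z' ≠ 0 → ∀ μ, |pos z μ - pos z' μ| ≤ 3 / 4 * M :=
    fun l z z' hne μ => (cut_local pos cΩ (S l) hcΩloc z z' hne μ).trans hM8
  have hq_loc : ∀ y z z', q y z ≠ 0 → q y z' ≠ 0 → ∀ μ, |pos z μ - pos z' μ| ≤ 3 / 4 * M :=
    fun y z z' h1 h2 μ => (hq y z z' h1 h2 μ).trans hM8
  -- sizes of the letters
  have hh0 : ∀ j z, 0 ≤ h j z := fun j z => hCube_nonneg M j (pos z)
  have hh1 : ∀ j z, |h j z| ≤ 1 := fun j z => abs_le.mpr ⟨by linarith [hh0 j z], hCube_le_one M j (pos z)⟩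
  have hnH : ∀ j, ‖mulH (ι := κ) (h j)‖ ≤ 1 := fun j => norm_mulH_le _ zero_le_one (hh1 j)
  have hnP : ‖P‖ ≤ 1 := norm_mulH_le _ zero_le_one fun z => by
    by_cases hz : z = x <;> simp [hz]
  have hnP' : ‖P'‖ ≤ 1 := norm_mulH_le _ zero_le_one fun z => by
    by_cases hz : F z <;> simp [hz]
  have hnA_gen : ∀ (Gx : Matrix (X × κ) (X × κ) ℝ) (j : Fin d → ℤ), ‖Gx‖ ≤ γ →
      ‖mulH (ι := κ) (h j) * Gx * mulH (ι := κ) (h j)‖ ≤ γ := by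
    intro Gx j hGx
    calc ‖mulH (ι := κ) (h j) * Gx * mulH (ι := κ) (h j)‖
        ≤ ‖mulH (ι := κ) (h j) * Gx‖ * ‖mulH (ι := κ) (h j)‖ := norm_mul_le _ _
      _ ≤ (‖mulH (ι := κ) (h j)‖ * ‖Gx‖) * ‖mulH (ι := κ) (h j)‖ :=
          mul_le_mul_of_nonneg_right (norm_mul_le _ _) (norm_nonneg _)
      _ ≤ (1 * γ) * 1 :=
          mul_le_mul (mul_le_mul (hnH j) hGx (norm_nonneg _) zero_le_one) (hnH j) (norm_nonneg _)
            (by rw [one_mul]; exact hγ0)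
      _ = γ := by ring
  have hnA : ∀ j : ↥s, ‖aJ j.1‖ ≤ γ := fun j => hnA_gen (Gj j.1) j.1 (hγ j)
  have hnAΩ : ∀ j : ↥s, ‖aΩ j.1‖ ≤ γ := fun j => hnA_gen (GjΩ j.1) j.1 (hγΩ j)
  -- `‖R‖, ‖R′‖ ≤ 2^dβ ≤ 1/2`
  have h23 : (2 : ℝ) ^ d * β ≤ (3 : ℝ) ^ d * β :=
    mul_le_mul_of_nonneg_right (pow_le_pow_left₀ (by norm_num) (by norm_num) d) hβ0
  have h3β' : (3 : ℝ) ^ d * β < 1 := h3β.trans_lt (Real.exp_lt_one_iff.mpr (by norm_num))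
  have hRhalf : ‖∑ j ∈ s, bJ j‖ ≤ 1 / 2 :=
    ((norm_R_le hM pos c m2 a q hc hq s S W' T' Gj hβ0 hβ).trans h23).trans (h3β.trans exp_neg_one_le_half)
  have hRΩhalf : ‖∑ j ∈ s, bΩ j‖ ≤ 1 / 2 :=
    ((norm_R_le hM pos cΩ m2 a q hcΩloc hq s S W' T' GjΩ hβ0 hβΩ).trans h23).trans (h3β.trans exp_neg_one_le_half)
  have hRlt : ‖∑ j ∈ s, bJ j‖ < 1 := hRhalf.trans_lt (by norm_num)
  have hRΩlt : ‖∑ j ∈ s, bΩ j‖ < 1 := hRΩhalf.trans_lt (by norm_num)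
  -- (2.9)–(2.12) for both propagators
  have h211 : covOp c m2 a q W T * ∑ j ∈ s, aJ j = 1 - ∑ j ∈ s, bJ j :=
    parametrix_identity_hCube hM pos c m2 a q W T s hs S hS hc hq W' T' hWW' hTT' Gj hGj
  have h211Ω : covOp cΩ m2 a q W T * ∑ j ∈ s, aΩ j = 1 - ∑ j ∈ s, bΩ j :=
    parametrix_identity_hCube hM pos cΩ m2 a q W T s hs S hS hcΩloc hq W' T' hWW' hTT' GjΩ hGjΩ
  have hGeq : G' * (1 - ∑ j ∈ s, bJ j) = ∑ j ∈ s, aJ j := G_mul_one_sub_eq hG'H h211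
  have hGeqΩ : G * (1 - ∑ j ∈ s, bΩ j) = ∑ j ∈ s, aΩ j := G_mul_one_sub_eq hGH h211Ω
  have hsum : HasSum (fun n : ℕ => (∑ j ∈ s, aJ j) * (∑ j ∈ s, bJ j) ^ n) G' := hasSum_neumann hRlt hGeq
  have hsumΩ : HasSum (fun n : ℕ => (∑ j ∈ s, aΩ j) * (∑ j ∈ s, bΩ j) ^ n) G := hasSum_neumann hRΩlt hGeqΩ
  -- `‖G₀‖, ‖G₀^Ω‖ ≤ 2^dγ` and `‖G‖, ‖G′‖ ≤ 2^{d+1}γ`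
  have hG0_gen : ∀ (Gx : (Fin d → ℤ) → Matrix (X × κ) (X × κ) ℝ), (∀ j : ↥s, ‖Gx j.1‖ ≤ γ) →
      ‖∑ j ∈ s, mulH (ι := κ) (h j) * Gx j * mulH (ι := κ) (h j)‖ ≤ (2 : ℝ) ^ d * γ := by
    intro Gx hGx
    have hmain := norm_sum_le_of_rowMult s (fun j => mulH (ι := κ) (h j) * Gx j * mulH (ι := κ) (h j)) hγ0
      (fun l hl => hnA_gen (Gx l) l (hGx ⟨l, hl⟩))
      (fun i : X × κ => Fintype.piFinset fun μ => ({⌊pos i.1 μ / M⌋, ⌊pos i.1 μ / M⌋ + 1} : Finset ℤ))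
      (m₀ := 2 ^ d) (fun i => card_labelBox_le M (pos i.1))
      (by
        rintro ⟨z, k⟩ l _ hln p
        have hlz : h l z = 0 := by
          by_contra hne
          exact hln (mem_box_of_hCube_ne_zero hne)
        rw [Matrix.mul_assoc, mulH_mul_apply, hlz, zero_mul])
    exact_mod_cast hmain
  have hG_gen : ∀ {Gbig G0 Rx : Matrix (X × κ) (X × κ) ℝ}, ‖Rx‖ ≤ 1 / 2 → Gbig * (1 - Rx) = G0 →
      ‖G0‖ ≤ (2 : ℝ) ^ d * γ → ‖Gbig‖ ≤ (2 : ℝ) ^ (d + 1) * γ := by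
    intro Gbig G0 Rx hRx hGx hG0x
    have h1 := norm_le_of_neumann (hRx.trans_lt (by norm_num)) hGx
    have hinv : (1 - ‖Rx‖)⁻¹ ≤ 2 := (inv_le_comm₀ (by linarith) two_pos).mpr (by linarith)
    calc ‖Gbig‖ ≤ ‖G0‖ * (1 - ‖Rx‖)⁻¹ := h1
      _ ≤ ((2 : ℝ) ^ d * γ) * 2 := mul_le_mul hG0x hinv (inv_nonneg.mpr (by linarith)) (by positivity)
      _ = (2 : ℝ) ^ (d + 1) * γ := by ring
  have hG' : ‖G'‖ ≤ (2 : ℝ) ^ (d + 1) * γ := hG_gen hRhalf hGeq (hG0_gen Gj hγ)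
  have hG : ‖G‖ ≤ (2 : ℝ) ^ (d + 1) * γ := hG_gen hRΩhalf hGeqΩ (hG0_gen GjΩ hγΩ)
  -- the exponent bookkeeping
  have hexp : Real.exp (-1) * (2 * Real.exp 2 * Real.exp (-((D + D₀ + D₁) / (2 * M) - 13 / 4)))
      = 2 * Real.exp (17 / 4) * Real.exp (-((D + D₀ + D₁) / (2 * M))) := by
    rw [show (17 / 4 : ℝ) = -1 + 2 + 13 / 4 by norm_num, Real.exp_add, Real.exp_add,
      show -((D + D₀ + D₁) / (2 * M) - 13 / 4) = 13 / 4 + -((D + D₀ + D₁) / (2 * M)) by ring, Real.exp_add]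
    ring
  by_cases hfar : 1 ≤ ⌊(D + D₀ + D₁) / (2 * M) - 13 / 4⌋₊
  · -- FAR: the cancellation of the two walk expansions
    set N : ℕ := ⌊(D + D₀ + D₁) / (2 * M) - 13 / 4⌋₊ with hNdef
    have hSig : 1 ≤ (D + D₀ + D₁) / (2 * M) - 13 / 4 := by
      by_contra hlt
      rw [not_le] at hlt
      have : N = 0 := Nat.floor_eq_zero.mpr hlt
      omega
    have hNle : (N : ℝ) ≤ (D + D₀ + D₁) / (2 * M) - 13 / 4 := Nat.floor_le (by linarith)
    have hNlt : (D + D₀ + D₁) / (2 * M) - 13 / 4 < N + 1 := Nat.lt_floor_add_one _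
    have hNM : ((N : ℝ) + 13 / 4) * M ≤ (D + D₀ + D₁) / 2 := by
      have : (N : ℝ) + 13 / 4 ≤ (D + D₀ + D₁) / 2 / M := by rw [div_div]; linarith
      rwa [le_div_iff₀ hM] at this
    -- interior cubes and the cubes meeting `Ω^c`
    set TΩ : Finset ↥s := Finset.univ.filter fun j : ↥s => ∃ z, S j.1 z ∧ ¬ Ω z with hTΩ
    have hagree : ∀ j : ↥s, j ∉ TΩ → aΩ j.1 = aJ j.1 ∧ bΩ j.1 = bJ j.1 := by
      intro j hj
      have hSΩ : ∀ z, S j.1 z → Ω z := by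
        intro z hz
        by_contra hΩz
        exact hj (Finset.mem_filter.mpr ⟨Finset.mem_univ _, z, hz, hΩz⟩)
      have hsupp : ∀ z, h j.1 z ≠ 0 → S j.1 z := fun z hz =>
        hS j.1 z fun μ => (hCube_ne_zero_imp hM hz μ).le.trans (by nlinarith)
      have hag := interior_letters_agree c m2 a q (W' j.1) (T' j.1) (S j.1) Ω hSΩ (hSq j.1) (h j.1) hsupp
        (hGj j.1 j.2) (hGjΩ j.1 j.2)
      exact ⟨hag.1.symm, hag.2.symm⟩
    -- the starting and the final cubes
    set S₀ : Finset ↥s := Finset.univ.filter fun i : ↥s => h i.1 x ≠ 0 with hS₀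
    set S₁ : Finset ↥s := Finset.univ.filter fun i : ↥s => ∃ x', F x' ∧ h i.1 x' ≠ 0 with hS₁
    have hP_gen : ∀ (Gx : Matrix (X × κ) (X × κ) ℝ) (i : ↥s), i ∉ S₀ →
        P * (mulH (ι := κ) (h i.1) * Gx * mulH (ι := κ) (h i.1)) = 0 := by
      intro Gx i hi
      have hix : h i.1 x = 0 := by
        by_contra hne
        exact hi (Finset.mem_filter.mpr ⟨Finset.mem_univ _, hne⟩)
      have hzero : P * mulH (ι := κ) (h i.1) = 0 := by
        rw [hPdef, mulH_mul_mulH]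
        refine mulH_eq_zero_of fun z => ?_
        by_cases hz : z = x
        · rw [hz, hix, mul_zero]
        · rw [if_neg hz, zero_mul]
      rw [← Matrix.mul_assoc, ← Matrix.mul_assoc, hzero, Matrix.zero_mul, Matrix.zero_mul]
    have hF0 : ∀ i : ↥s, i ∉ S₁ → mulH (ι := κ) (h i.1) * P' = 0 := by
      intro i hi
      rw [hP'def, mulH_mul_mulH]
      refine mulH_eq_zero_of fun z => ?_
      by_cases hz : F z
      · have hiz : h i.1 z = 0 := by
          by_contra hne
          exact hi (Finset.mem_filter.mpr ⟨Finset.mem_univ _, z, hz, hne⟩)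
        rw [hiz, zero_mul]
      · rw [if_neg hz, mul_zero]
    have hP'_gen : ∀ (Kx : Matrix (X × κ) (X × κ) ℝ) (i : ↥s), i ∉ S₁ → Kx * mulH (ι := κ) (h i.1) * P' = 0 := by
      intro Kx i hi
      rw [Matrix.mul_assoc, hF0 i hi, Matrix.mul_zero]
    have hα_gen : ∀ (A : Matrix (X × κ) (X × κ) ℝ), ‖A‖ ≤ γ → ‖P * A‖ ≤ γ := fun A hA =>
      (norm_mul_le _ _).trans (by
        calc ‖P‖ * ‖A‖ ≤ 1 * γ := mul_le_mul hnP hA (norm_nonneg _) zero_le_one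
          _ = γ := one_mul γ)
    have hβ₁_gen : ∀ (B : Matrix (X × κ) (X × κ) ℝ), ‖B‖ ≤ β → ‖B * P'‖ ≤ β := fun B hB =>
      (norm_mul_le _ _).trans (by
        calc ‖B‖ * ‖P'‖ ≤ β * 1 := mul_le_mul hB hnP' (norm_nonneg _) hβ0
          _ = β := mul_one β)
    -- the separation THROUGH a cube meeting `Ω^c`
    have hsep : ∀ i ∈ S₀, ∀ t ∈ TΩ, ∀ l ∈ S₁, ∃ μ ν, (N : ℤ) ≤ |i.1 μ - t.1 μ| + |t.1 ν - l.1 ν| := by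
      intro i hi t ht l hl
      obtain ⟨-, hix⟩ := Finset.mem_filter.mp hi
      obtain ⟨-, x₁, hSx₁, hΩx₁⟩ := Finset.mem_filter.mp ht
      obtain ⟨-, x', hFx', hlx'⟩ := Finset.mem_filter.mp hl
      have hi5 : ∀ μ, |pos x μ - M * i.1 μ| < 5 / 8 * M := hCube_ne_zero_imp hM hix
      have ht1 : ∀ μ, |pos x₁ μ - M * t.1 μ| ≤ M := hS1 t.1 x₁ hSx₁
      have hl5 : ∀ μ, |pos x' μ - M * l.1 μ| < 5 / 8 * M := hCube_ne_zero_imp hM hlx'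
      -- label distances from site distances
      have hit : ∀ μ, |pos x μ - pos x₁ μ| - 13 / 8 * M < M * |((i.1 μ : ℤ) : ℝ) - t.1 μ| := by
        intro μ
        have htri : |pos x μ - pos x₁ μ| ≤ |pos x μ - M * i.1 μ| + |M * i.1 μ - M * t.1 μ| + |pos x₁ μ - M * t.1 μ| := by
          calc |pos x μ - pos x₁ μ|
              = |(pos x μ - M * i.1 μ) + (M * i.1 μ - M * t.1 μ) + (M * t.1 μ - pos x₁ μ)| := by ring_nf
            _ ≤ |pos x μ - M * i.1 μ| + |M * i.1 μ - M * t.1 μ| + |M * t.1 μ - pos x₁ μ| := abs_add_three _ _ _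
            _ = _ := by rw [abs_sub_comm (M * t.1 μ) (pos x₁ μ)]
        rw [← mul_sub, abs_mul, abs_of_pos hM] at htri
        linarith [hi5 μ, ht1 μ]
      have htl : ∀ ν, |pos x₁ ν - pos x' ν| - 13 / 8 * M < M * |((t.1 ν : ℤ) : ℝ) - l.1 ν| := by
        intro ν
        have htri : |pos x₁ ν - pos x' ν| ≤ |pos x₁ ν - M * t.1 ν| + |M * t.1 ν - M * l.1 ν| + |pos x' ν - M * l.1 ν| := by
          calc |pos x₁ ν - pos x' ν|
              = |(pos x₁ ν - M * t.1 ν) + (M * t.1 ν - M * l.1 ν) + (M * l.1 ν - pos x' ν)| := by ring_nf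
            _ ≤ |pos x₁ ν - M * t.1 ν| + |M * t.1 ν - M * l.1 ν| + |M * l.1 ν - pos x' ν| := abs_add_three _ _ _
            _ = _ := by rw [abs_sub_comm (M * l.1 ν) (pos x' ν)]
        rw [← mul_sub, abs_mul, abs_of_pos hM] at htri
        linarith [ht1 ν, hl5 ν]
      -- the two cases «max(D, D₀ + D₁) ≥ (D + D₀ + D₁)/2»
      have key : ∃ μ ν, (D + D₀ + D₁) / 2 ≤ |pos x μ - pos x₁ μ| + |pos x₁ ν - pos x' ν| := by
        by_cases hcase : D ≤ D₀ + D₁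
        · obtain ⟨μ, hμ⟩ := hD₀ x₁ hΩx₁
          obtain ⟨ν, hν⟩ := hD₁ x' hFx' x₁ hΩx₁
          exact ⟨μ, ν, by linarith⟩
        · obtain ⟨μ, hμ⟩ := hD x' hFx'
          refine ⟨μ, μ, ?_⟩
          have htri : |pos x μ - pos x' μ| ≤ |pos x μ - pos x₁ μ| + |pos x₁ μ - pos x' μ| := by
            calc |pos x μ - pos x' μ| = |(pos x μ - pos x₁ μ) + (pos x₁ μ - pos x' μ)| := by ring_nf
              _ ≤ _ := abs_add_le _ _
          linarith
      obtain ⟨μ, ν, hμν⟩ := key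
      refine ⟨μ, ν, ?_⟩
      have hsum' : (N : ℝ) * M < M * |((i.1 μ : ℤ) : ℝ) - t.1 μ| + M * |((t.1 ν : ℤ) : ℝ) - l.1 ν| := by
        linarith [hit μ, htl ν]
      rw [← mul_add] at hsum'
      have h5 : (N : ℝ) < |((i.1 μ : ℤ) : ℝ) - t.1 μ| + |((t.1 ν : ℤ) : ℝ) - l.1 ν| := by
        by_contra hle
        rw [not_lt] at hle
        have := mul_le_mul_of_nonneg_left hle hM.le
        linarith
      have h6 : ((N : ℤ) : ℝ) < ((|i.1 μ - t.1 μ| + |t.1 ν - l.1 ν| : ℤ) : ℝ) := by push_cast; exact h5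
      exact (Int.cast_lt.mp h6).le
    have hcardS₀ : S₀.card ≤ 2 ^ d := by
      have hsub : S₀.map (Function.Embedding.subtype (· ∈ s))
          ⊆ Fintype.piFinset fun μ => ({⌊pos x μ / M⌋, ⌊pos x μ / M⌋ + 1} : Finset ℤ) := by
        intro j hj
        obtain ⟨i, hi, rfl⟩ := Finset.mem_map.mp hj
        obtain ⟨-, hix⟩ := Finset.mem_filter.mp hi
        exact mem_box_of_hCube_ne_zero hix
      calc S₀.card = (S₀.map (Function.Embedding.subtype (· ∈ s))).card := (Finset.card_map _).symm
        _ ≤ _ := Finset.card_le_card hsub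
        _ ≤ 2 ^ d := card_labelBox_le M (pos x)
    -- locality of the letters (non-neighbouring cubes)
    have hloc_gen : ∀ (cx : (Fin d → ℤ) → X → X → ℝ),
        (∀ l z z', cx l z z' ≠ 0 → ∀ μ, |pos z μ - pos z' μ| ≤ 3 / 4 * M) →
        ∀ i l : ↥s, ¬ cubeAdj (fun i : ↥s => i.1) i l →
          mulH (ι := κ) (h i.1) * opK (cx l.1) m2 a q (W' l.1) (T' l.1) (h l.1) = 0 :=
      fun cx hcx i l hil => mulH_hCube_mul_opK_eq_zero hM pos (cx l.1) m2 a q (W' l.1) (T' l.1) (hcx l.1) hq_loc hil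
    have hab_gen : ∀ (cx : (Fin d → ℤ) → X → X → ℝ) (Gx : (Fin d → ℤ) → Matrix (X × κ) (X × κ) ℝ),
        (∀ l z z', cx l z z' ≠ 0 → ∀ μ, |pos z μ - pos z' μ| ≤ 3 / 4 * M) →
        ∀ i l : ↥s, ¬ cubeAdj (fun i : ↥s => i.1) i l →
          (mulH (ι := κ) (h i.1) * Gx i.1 * mulH (ι := κ) (h i.1))
            * (opK (cx l.1) m2 a q (W' l.1) (T' l.1) (h l.1) * Gx l.1 * mulH (ι := κ) (h l.1)) = 0 := by
      intro cx Gx hcx i l hil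
      rw [show mulH (ι := κ) (h i.1) * Gx i.1 * mulH (ι := κ) (h i.1)
            * (opK (cx l.1) m2 a q (W' l.1) (T' l.1) (h l.1) * Gx l.1 * mulH (ι := κ) (h l.1))
          = mulH (ι := κ) (h i.1) * Gx i.1
            * (mulH (ι := κ) (h i.1) * opK (cx l.1) m2 a q (W' l.1) (T' l.1) (h l.1))
            * Gx l.1 * mulH (ι := κ) (h l.1) by simp only [Matrix.mul_assoc],
        hloc_gen cx hcx i l hil, Matrix.mul_zero, Matrix.zero_mul, Matrix.zero_mul]
    have hbb_gen : ∀ (cx : (Fin d → ℤ) → X → X → ℝ) (Gx : (Fin d → ℤ) → Matrix (X × κ) (X × κ) ℝ),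
        (∀ l z z', cx l z z' ≠ 0 → ∀ μ, |pos z μ - pos z' μ| ≤ 3 / 4 * M) →
        ∀ i l : ↥s, ¬ cubeAdj (fun i : ↥s => i.1) i l →
          (opK (cx i.1) m2 a q (W' i.1) (T' i.1) (h i.1) * Gx i.1 * mulH (ι := κ) (h i.1))
            * (opK (cx l.1) m2 a q (W' l.1) (T' l.1) (h l.1) * Gx l.1 * mulH (ι := κ) (h l.1)) = 0 := by
      intro cx Gx hcx i l hil
      rw [show opK (cx i.1) m2 a q (W' i.1) (T' i.1) (h i.1) * Gx i.1 * mulH (ι := κ) (h i.1)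
            * (opK (cx l.1) m2 a q (W' l.1) (T' l.1) (h l.1) * Gx l.1 * mulH (ι := κ) (h l.1))
          = opK (cx i.1) m2 a q (W' i.1) (T' i.1) (h i.1) * Gx i.1
            * (mulH (ι := κ) (h i.1) * opK (cx l.1) m2 a q (W' l.1) (T' l.1) (h l.1))
            * Gx l.1 * mulH (ι := κ) (h l.1) by simp only [Matrix.mul_assoc],
        hloc_gen cx hcx i l hil, Matrix.mul_zero, Matrix.zero_mul, Matrix.zero_mul]
    have hr : ((N : ℝ) + 1) - 2 ≤ ((N - 1 : ℕ) : ℝ) := by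
      rw [Nat.cast_sub hfar, Nat.cast_one]; linarith
    -- the abstract cancellation bound over the finite label type `↥s`
    have hwalk := lattice_walk_delta_bound (R := Matrix (X × κ) (X × κ) ℝ) (fun i : ↥s => i.1) Subtype.val_injective
      (a := fun i : ↥s => aΩ i.1) (b := fun i : ↥s => bΩ i.1) (a' := fun i : ↥s => aJ i.1) (b' := fun i : ↥s => bJ i.1)
      (P := P) (P' := P') (S₀ := S₀) (S₁ := S₁) (T := TΩ) (α := γ) (β := β) (β₁ := β) (N := N)
      (by rw [Finset.sum_coe_sort s aΩ]) (by rw [Finset.sum_coe_sort s bΩ])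
      (by rw [Finset.sum_coe_sort s aJ]) (by rw [Finset.sum_coe_sort s bJ]) hsumΩ hsum
      (hab_gen cutΩ GjΩ hcutΩ_loc) (hbb_gen cutΩ GjΩ hcutΩ_loc) (hab_gen cut Gj hcut_loc) (hbb_gen cut Gj hcut_loc)
      (fun i hi => (hagree i hi).1) (fun i hi => (hagree i hi).2)
      (fun i hi => hP_gen (GjΩ i.1) i hi) (fun i hi => hP_gen (Gj i.1) i hi)
      (fun i hi => hP'_gen _ i hi) (fun i hi => hP'_gen _ i hi) (fun i hi => hP'_gen _ i hi) (fun i hi => hP'_gen _ i hi)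
      (fun i => hα_gen _ (hnAΩ i)) (fun i => hα_gen _ (hnA i)) hβ0 hβΩ hβ (fun i => hβ₁_gen _ (hβΩ i))
      (fun i => hβ₁_gen _ (hβ i)) h3β' hfar hsep
    rw [mul_div_assoc] at hwalk
    have htail := tail_222 (by positivity : 0 ≤ (3 : ℝ) ^ d * β) h3β hr
    have hEN : Real.exp (-((N : ℝ) + 1)) ≤ Real.exp (-((D + D₀ + D₁) / (2 * M) - 13 / 4)) :=
      Real.exp_le_exp.mpr (by linarith)
    calc ‖P * (G - G') * P'‖
        ≤ 2 * (S₀.card * γ * β * (3 : ℝ) ^ d * (((3 : ℝ) ^ d * β) ^ (N - 1) / (1 - (3 : ℝ) ^ d * β))) := hwalk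
      _ ≤ 2 * ((2 : ℝ) ^ d * γ * β * (3 : ℝ) ^ d * (2 * Real.exp 2 * Real.exp (-((N : ℝ) + 1)))) := by
          gcongr
          exact_mod_cast hcardS₀
      _ ≤ 2 * ((2 : ℝ) ^ d * γ * β * (3 : ℝ) ^ d
          * (2 * Real.exp 2 * Real.exp (-((D + D₀ + D₁) / (2 * M) - 13 / 4)))) := by gcongr
      _ = (2 : ℝ) ^ (d + 1) * γ
          * (((3 : ℝ) ^ d * β) * (2 * Real.exp 2 * Real.exp (-((D + D₀ + D₁) / (2 * M) - 13 / 4)))) := by ring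
      _ ≤ (2 : ℝ) ^ (d + 1) * γ
          * (Real.exp (-1) * (2 * Real.exp 2 * Real.exp (-((D + D₀ + D₁) / (2 * M) - 13 / 4)))) := by gcongr
      _ = 2 ^ (d + 2) * Real.exp (17 / 4) * γ * Real.exp (-((D + D₀ + D₁) / (2 * M))) := by rw [hexp]; ring
  · -- NEAR (`(D + D₀ + D₁)/(2M) < 17/4`): the sizes of the two Neumann series
    rw [not_le, Nat.lt_one_iff, Nat.floor_eq_zero] at hfar
    have hE : 1 ≤ Real.exp (17 / 4) * Real.exp (-((D + D₀ + D₁) / (2 * M))) := by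
      rw [← Real.exp_add]
      exact Real.one_le_exp_iff.mpr (by linarith)
    calc ‖P * (G - G') * P'‖ ≤ ‖P * (G - G')‖ * ‖P'‖ := norm_mul_le _ _
      _ ≤ (‖P‖ * ‖G - G'‖) * ‖P'‖ := mul_le_mul_of_nonneg_right (norm_mul_le _ _) (norm_nonneg _)
      _ ≤ (1 * ((2 : ℝ) ^ (d + 1) * γ + (2 : ℝ) ^ (d + 1) * γ)) * 1 :=
          mul_le_mul (mul_le_mul hnP ((norm_sub_le _ _).trans (add_le_add hG hG')) (norm_nonneg _) zero_le_one)
            hnP' (norm_nonneg _) (by rw [one_mul]; positivity)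
      _ = (2 : ℝ) ^ (d + 2) * γ * 1 := by ring
      _ ≤ (2 : ℝ) ^ (d + 2) * γ * (Real.exp (17 / 4) * Real.exp (-((D + D₀ + D₁) / (2 * M)))) := by gcongr
      _ = 2 ^ (d + 2) * Real.exp (17 / 4) * γ * Real.exp (-((D + D₀ + D₁) / (2 * M))) := by ring

/-- **(1.11)–(1.12) AS PRINTED, value member**: for `f` supported in `F` with `sup|f| ≤ φ`,
`|(δG_k(Ω,Ω₀,A)f)(x)| ≤ c₀·exp(−(2M)⁻¹(dist(x,supp f) + dist(x,Ω^c) + dist(supp f,Ω^c)))·‖f‖_∞` with `c₀ = 2^{d+2}e^{17/4}γ`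
— the `mulVec` form of `ineq112_value`. [cite: Balaban1983RegularityDecay, Theorem (1.11)–(1.12) p.573; p.579] -/
theorem ineq112_value_apply {M : ℝ} (hM : 0 < M) (pos : X → Fin d → ℝ) (c : X → X → ℝ) (m2 a : ℝ)
    (q : Y → X → ℝ) (W : X → X → Matrix κ κ ℝ) (T : Y → X → Matrix κ κ ℝ)
    (hc : ∀ x z', c x z' ≠ 0 → ∀ μ, |pos x μ - pos z' μ| ≤ 1 / 8 * M)
    (hq : ∀ y x z', q y x ≠ 0 → q y z' ≠ 0 → ∀ μ, |pos x μ - pos z' μ| ≤ 1 / 8 * M)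
    (s : Finset (Fin d → ℤ)) (hs : ∀ j x, hCube M j (pos x) ≠ 0 → j ∈ s)
    (S : (Fin d → ℤ) → X → Prop) [∀ j, DecidablePred (S j)]
    (hS : ∀ j z, (∀ μ, |pos z μ - M * j μ| ≤ 7 / 8 * M) → S j z)
    (hS1 : ∀ j z, S j z → ∀ μ, |pos z μ - M * j μ| ≤ M)
    (hSq : ∀ j y z z', q y z ≠ 0 → q y z' ≠ 0 → (S j z ↔ S j z'))
    (W' : (Fin d → ℤ) → X → X → Matrix κ κ ℝ) (T' : (Fin d → ℤ) → Y → X → Matrix κ κ ℝ)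
    (hWW' : ∀ j x z', (∀ μ, |pos x μ - M * j μ| ≤ 3 / 4 * M) → (∀ μ, |pos z' μ - M * j μ| ≤ 3 / 4 * M) →
      W' j x z' = W x z')
    (hTT' : ∀ j y x, q y x ≠ 0 → (∀ μ, |pos x μ - M * j μ| ≤ 3 / 4 * M) → T' j y x = T y x)
    (Ω : X → Prop) [DecidablePred Ω]
    (Gj : (Fin d → ℤ) → Matrix (X × κ) (X × κ) ℝ)
    (hGj : ∀ j ∈ s, covOp (fun z z' => if (S j z ↔ S j z') then c z z' else 0) m2 a q (W' j) (T' j) * Gj j = 1)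
    (GjΩ : (Fin d → ℤ) → Matrix (X × κ) (X × κ) ℝ)
    (hGjΩ : ∀ j ∈ s, covOp (fun z z' => if (S j z ↔ S j z') then (if (Ω z ↔ Ω z') then c z z' else 0) else 0)
      m2 a q (W' j) (T' j) * GjΩ j = 1)
    (G : Matrix (X × κ) (X × κ) ℝ) (hGH : G * covOp (fun z z' => if (Ω z ↔ Ω z') then c z z' else 0) m2 a q W T = 1)
    (G' : Matrix (X × κ) (X × κ) ℝ) (hG'H : G' * covOp c m2 a q W T = 1)
    {γ β : ℝ} (hγ0 : 0 ≤ γ) (hγ : ∀ i : ↥s, ‖Gj i.1‖ ≤ γ) (hγΩ : ∀ i : ↥s, ‖GjΩ i.1‖ ≤ γ) (hβ0 : 0 ≤ β)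
    (hβ : ∀ i : ↥s, ‖opK (fun z z' => if (S i.1 z ↔ S i.1 z') then c z z' else 0) m2 a q (W' i.1) (T' i.1)
        (fun z => hCube M i.1 (pos z)) * Gj i.1 * mulH (ι := κ) (fun z => hCube M i.1 (pos z))‖ ≤ β)
    (hβΩ : ∀ i : ↥s, ‖opK (fun z z' => if (S i.1 z ↔ S i.1 z') then (if (Ω z ↔ Ω z') then c z z' else 0) else 0)
        m2 a q (W' i.1) (T' i.1) (fun z => hCube M i.1 (pos z)) * GjΩ i.1
        * mulH (ι := κ) (fun z => hCube M i.1 (pos z))‖ ≤ β)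
    (h3β : (3 : ℝ) ^ d * β ≤ Real.exp (-1))
    (x : X) (F : X → Prop) [DecidablePred F] {D D₀ D₁ : ℝ}
    (hD : ∀ x', F x' → ∃ μ, D ≤ |pos x μ - pos x' μ|)
    (hD₀ : ∀ x₁, ¬ Ω x₁ → ∃ μ, D₀ ≤ |pos x μ - pos x₁ μ|)
    (hD₁ : ∀ x', F x' → ∀ x₁, ¬ Ω x₁ → ∃ μ, D₁ ≤ |pos x₁ μ - pos x' μ|)
    (f : X × κ → ℝ) (hfF : ∀ p, ¬ F p.1 → f p = 0) {φ : ℝ} (hφ : 0 ≤ φ) (hf : ∀ p, |f p| ≤ φ) (k : κ) :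
    |((G - G') *ᵥ f) (x, k)| ≤ 2 ^ (d + 2) * Real.exp (17 / 4) * γ * Real.exp (-((D + D₀ + D₁) / (2 * M))) * φ := by
  have hmain := ineq112_value hM pos c m2 a q W T hc hq s hs S hS hS1 hSq W' T' hWW' hTT' Ω Gj hGj GjΩ hGjΩ G hGH G' hG'H hγ0 hγ hγΩ hβ0 hβ hβΩ h3β x F hD hD₀ hD₁
  have hP'f : mulH (ι := κ) (fun z => if F z then (1 : ℝ) else 0) *ᵥ f = f := by
    ext p
    rw [mulH_mulVec_apply]
    by_cases hz : F p.1
    · rw [if_pos hz, one_mul]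
    · rw [if_neg hz, zero_mul, hfF p hz]
  have hentry : ((mulH (ι := κ) (fun z => if z = x then (1 : ℝ) else 0) * (G - G')
      * mulH (ι := κ) (fun z => if F z then (1 : ℝ) else 0)) *ᵥ f) (x, k) = ((G - G') *ᵥ f) (x, k) := by
    rw [← Matrix.mulVec_mulVec, ← Matrix.mulVec_mulVec, hP'f, mulH_mulVec_apply, if_pos rfl, one_mul]
  rw [← hentry]
  exact (abs_mulVec_le _ f hφ hf (x, k)).trans (mul_le_mul_of_nonneg_right hmain hφ)

end Route

end Literature.MathematicalPhysics.QuantumFieldTheory.Balaban1983to89.B4Ineq112WalkRoute
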